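import Literature.NumberTheory.EllipticCurves.HeegnerPointsKolyvaginSplitDescentData
import Literature.NumberTheory.EllipticCurves.HeegnerPointsKolyvaginClassesPointsProofs
import Literature.NumberTheory.EllipticCurves.BSDRankZeroDensity
import Summits.BirchSwinnertonDyer.Rank1Residual.P2.CMKolyvaginMachineBindersAtTwo
import HarnessLib

/-!
# Route `CMKolyvaginAtInertTwo`, crux `CMKolyvaginExactAtInertTwo` (stmt-BirchSwinnertonDyer-24277):
# THE EIGEN-PAIR CURRENCY AT `p = 2`, I: `V = H¹(K, E[2^M])^{ε} × H¹(K, E[2^M])^{−ε}`, its local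
# conditions, and Kolyvagin's classes of a point system placed by sign (the pieces of the
# `SplitDataM` instance `pairData` of the sequel `…PairDataAtTwo`)

Seat `bsd-line-cmk2-p1` g13 (cell `bsd-print-cf2`); helper (`--supports stmt-BirchSwinnertonDyer-24277`).
No named fact, no `sorry`; definitions (the currency: `eigK`, `PairV`, `Places`, `pairLoc`, `pairA`,
`pairPl`, `cK`, `pairEig`, `pairSel`, `pairC`, `pairX`) with their lemmas; no item is closed; BSD is not
proved by this. The instance itself (`pairData`) is the sequel `…PairDataAtTwo` (400-line cap).

WHY. The adaptive split-form Cassels–Tate telescope (`KolyvaginAdaptiveData.card_mul_card_le_of_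
casselsTate_adaptive`, this seat) is a theorem about an abstract `S : SplitDataM V Pl` (the data
carrier without the Čebotarev / duality axioms, `Literature.….HeegnerPointsKolyvaginSplitDescentData`).
For it to bear on the crux one needs an INSTANCE at `p = 2`. The tree's `p = 2` kernel (seats g3–g12)
lives over `K` in `H¹(K, E[2^M])` (`galH1Torsion`, `selmerGroup`, `conjAct`, `kolyvaginClass`, the
Čebotarev leaves), and its arithmetic input is ty2's DATUM `PointSystem N W K P 2 S M hdiv c` (Gross
(4.4), Props. 5.3, 6.2 = McCallum Lemma 4.3, Prop. 4.4, with the prime free; discharged on H₂ modulo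
print by g9's `CMPointSystemTwo.nonempty_pointSystemFamily_two_of_cmInert_of_printedInputs`). Over `K`
the `τ`-eigengroups of `H¹(K, E[2^M])` do NOT meet trivially at `2`; Kolyvagin's frame at `l = 2`
(Izv. 1989 §3: the pair `(E, E^{d_K})` over `ℚ`) is, by inflation–restriction (`E(K)[2] = 0`), the
EXTERNAL product of the two eigengroups. So:

* `eigK W c M ν` — the `ν`-eigengroup `{g : c_* g = ν g} ≤ H¹(K, E[2^M])`;
* `pairData` — for a point system `D` at `(2, M)` (support `S`), a point `x₀ ∈ E(K)` with
  `2^{M₀} x₀ = P` whose Kummer class is an `ε`-eigenclass, the `SplitDataM` on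
  `V = ↥(eigK ε) × ↥(eigK (−ε))`, places `Pl = (finite places of K) ⊕ (infinite places)`:
  `eig (±ε)` the two factors; `Sel`, `Loc v`, `A ℓ` = the product of the traces of `Sel_{2^M}(E/K)`,
  of the local kernels `selmerLocalKer` at `v`, of the strict kernels `torsionLocalKer` at `λ = (ℓ)`;
  `Kol ℓ` = "`ℓ` is a Kolyvagin prime of `(2, M)` in Gross's form with `S ℓ`"; `x = (δ x₀, 0)`;
  `c n` = Kolyvagin's class of `P_n` placed in the factor of its sign `ε(−1)^{r(n)}` (Gross Prop. 5.4
  (2), from `D.rel`); `c_mem_loc` = Prop. 6.2 (1) (+ nothing at the complex places);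
  `c_mem_loc_iff` = Prop. 6.2 (2) (McCallum Prop. 4.4) ACROSS the factors; `x_ord` from `x₀ ∉ 2E(K)`
  (mod `2^M`), via the Kummer kernel;
* unfolding lemmas (`pairData_p`, `…_M`, `…_M₀`, `…_ε`, `mem_pairData_sel_iff`, `pairData_kol_iff`,
  `mem_pairData_A_iff`, …) and the kernel `Δ` of `V → H¹(K, E[2^M])`, `(u, v) ↦ u + v`, with its
  purity (`pairDelta`, `mem_pairDelta_iff`, `eq_zero_of_mem_pairDelta_of_mem_eig` = the hypothesis
  `hΔpure` of the telescope).

What is NOT here: the telescope's analytic hypotheses for this instance (`hCTV` from ty2's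
`ReciprocityFamily` + Cassels–Tate, `hCeb₂` from the Čebotarev leaf p669091 + the criterion p670347),
the lift groups, and the H₂-discharge of the hypotheses `hxε`, `hx` (g0/g7: no `2`-torsion, the
`M₀`-clause conversion). References: [GrossLMS1991] (4.4), Props. 5.3, 5.4 (2), 6.2; [McCallumLMS1991]
Lemma 4.3, Prop. 4.4, Lemma 5.1; [Kolyvagin1989Izv] §3.
-/

-- single-conjunct summit: `Summit.BirchSwinnertonDyer.BirchSwinnertonDyer.…` repeats the name by design
set_option linter.dupNamespace false
set_option autoImplicit false

noncomputable section

open scoped Classical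
open WeierstrassCurve NumberField IsDedekindDomain
open Literature.NumberTheory.GaloisRepresentations
open Literature.NumberTheory.EllipticCurves Literature.NumberTheory.EllipticCurves.KolyvaginDescent
open Summit.BirchSwinnertonDyer.Rank1Residual.P2.KolyvaginMachine

namespace Summit.BirchSwinnertonDyer.BirchSwinnertonDyer.Theorems.KolyvaginPairDataTwo

variable {N : ℕ} (W : WeierstrassCurve ℚ) {K : Type} [Field K] [NumberField K]

/-! ## The eigengroups of `c_*` on `H¹(K, E[2^M])` -/

/-- The `ν`-eigengroup of the conjugation `c_*` on `H¹(K, E[2^M])`: `{g : c_* g = ν • g}` (Gross 1991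
(5.1) at `p = 2`, where the two eigengroups need not span and need not meet trivially).
[cite: GrossLMS1991, §5 (5.1)] -/
def eigK (c : K ≃ₐ[ℚ] K) (M : ℕ) (ν : ℤ) : AddSubgroup (galH1Torsion (W.baseChange K) ((2 ^ M : ℕ) : ℤ)) where
  carrier := {g | conjAct W c ((2 ^ M : ℕ) : ℤ) g = ν • g}
  zero_mem' := by
    rw [Set.mem_setOf_eq, map_zero, zsmul_zero]
  add_mem' := by
    intro a b ha hb
    simp only [Set.mem_setOf_eq] at ha hb ⊢
    rw [map_add, ha, hb, zsmul_add]
  neg_mem' := by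
    intro a ha
    simp only [Set.mem_setOf_eq] at ha ⊢
    rw [map_neg, ha, zsmul_neg]

/-- Membership in the eigengroup. [cite: GrossLMS1991, §5 (5.1)] -/
theorem mem_eigK_iff (c : K ≃ₐ[ℚ] K) (M : ℕ) (ν : ℤ) (g : galH1Torsion (W.baseChange K) ((2 ^ M : ℕ) : ℤ)) :
    g ∈ eigK W c M ν ↔ conjAct W c ((2 ^ M : ℕ) : ℤ) g = ν • g :=
  Iff.rfl

/-- The carrier of the split data at `2`: `V = H¹(K, E[2^M])^{ε} × H¹(K, E[2^M])^{−ε}` (external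
product of the two eigengroups = Kolyvagin's pair `(E^{ε}, E^{−ε})` over `ℚ` by inflation–restriction).
[cite: Kolyvagin1989Izv, §3 (the pair (E, E^D) over ℚ at l = 2)] -/
abbrev PairV (c : K ≃ₐ[ℚ] K) (M : ℕ) (ε : ℤ) : Type :=
  ↥(eigK W c M ε) × ↥(eigK W c M (-ε))

/-- The places indexing the local conditions: finite places of `K` and infinite places of `K`.
[folklore] -/
abbrev Places (K : Type) [Field K] [NumberField K] : Type :=
  HeightOneSpectrum (𝓞 K) ⊕ InfinitePlace K

section Instance

variable (c : K ≃ₐ[ℚ] K) (M : ℕ)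
  (hdiv : ∀ Q : geomPoints (W.baseChange K), ∃ R, ((2 ^ M : ℕ) : ℤ) • R = Q)
  {S : ℕ → Prop} {P : (W.baseChange K).toAffine.Point}

/-- The local condition at a place, on the pair: both components satisfy the Selmer condition there.
[cite: McCallumLMS1991, §4 (the Selmer group `S_{p^M}(E/K)`)] -/
def pairLoc (ε : ℤ) : Places K → AddSubgroup (PairV W c M ε)
  | Sum.inl v => ((selmerLocalKer (W.baseChange K) (v.adicCompletion K) ((2 ^ M : ℕ) : ℤ)).comap
        (eigK W c M ε).subtype).prod
      ((selmerLocalKer (W.baseChange K) (v.adicCompletion K) ((2 ^ M : ℕ) : ℤ)).comap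
        (eigK W c M (-ε)).subtype)
  | Sum.inr w => ((selmerLocalKer (W.baseChange K) w.Completion ((2 ^ M : ℕ) : ℤ)).comap
        (eigK W c M ε).subtype).prod
      ((selmerLocalKer (W.baseChange K) w.Completion ((2 ^ M : ℕ) : ℤ)).comap
        (eigK W c M (-ε)).subtype)

/-- The strict condition "`c_λ = 0`" at the place `λ = (ℓ)` of a Kolyvagin prime, on the pair (`⊤` off
Kolyvagin primes). [cite: McCallumLMS1991, §3 (3) and §5 (19)] -/
def pairA (ε : ℤ) (ℓ : ℕ) : AddSubgroup (PairV W c M ε) :=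
  if h : IsKolyvaginPrime N W K 2 ℓ then
    (((W.baseChange K).torsionLocalKer (h.place.adicCompletion K) ((2 ^ M : ℕ) : ℤ)).comap
        (eigK W c M ε).subtype).prod
      (((W.baseChange K).torsionLocalKer (h.place.adicCompletion K) ((2 ^ M : ℕ) : ℤ)).comap
        (eigK W c M (-ε)).subtype)
  else ⊤

/-- The place of a Kolyvagin prime (junk off Kolyvagin primes). [cite: GrossLMS1991, §3 (after (3.2))] -/
def pairPl (ℓ : ℕ) : Places K :=
  if h : IsKolyvaginPrime N W K 2 ℓ then Sum.inl h.place else Sum.inr (Classical.ofNonempty)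

/-- Kolyvagin's class of `P_n` at level `2^M`, as an element of `H¹(K, E[2^M])`. [cite: GrossLMS1991, §4 (4.4)] -/
def cK (D : PointSystem N W K P 2 S M hdiv c) (n : ℕ) : galH1Torsion (W.baseChange K) ((2 ^ M : ℕ) : ℤ) :=
  kolyvaginClass (W.baseChange K) _ hdiv (D.hA n) (D.Pt n) (D.hPt n)

/-- **Gross Prop. 5.4 (2) for the point system**: for a square-free `n` supported on the data's
Kolyvagin primes, `c_* c(n) = ε(−1)^{r(n)} c(n)`. [cite: GrossLMS1991, Prop. 5.4 (2)] -/
theorem cK_mem_eigK (D : PointSystem N W K P 2 S M hdiv c) {n : ℕ} (hn : KolSupp (fun ℓ ↦ IsKolyvaginPrime N W K 2 ℓ ∧ FrobEqFrobInfty W K (2 ^ M) ℓ ∧ S ℓ) n) :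
    cK W c M hdiv D n ∈ eigK W c M (D.ε * (-1) ^ n.primeFactors.card) := by
  rw [mem_eigK_iff]
  exact conjAct_kolyvaginClass_eq_smul W (hdiv := hdiv) D.hτ (D.hA n) (D.A_stable n) (D.hPt n) _
    (D.rel n hn.1 hn.2).1

/-- `−ε ≠ ε` for a sign. [folklore] -/
private theorem neg_ne_self_of_sign {ε : ℤ} (hε : ε = 1 ∨ ε = -1) : -ε ≠ ε := by
  rcases hε with rfl | rfl <;> decide

/-- The eigengroups of the pair: `eig ε = V^{ε} × 0`, `eig (−ε) = 0 × V^{−ε}`, `⊥` at other integers.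
[cite: Kolyvagin1989Izv, §3] -/
def pairEig (ε ν : ℤ) : AddSubgroup (PairV W c M ε) :=
  if ν = ε then (⊤ : AddSubgroup ↥(eigK W c M ε)).prod ⊥
  else if ν = -ε then (⊥ : AddSubgroup ↥(eigK W c M ε)).prod ⊤ else ⊥

/-- `eig ε = V^{ε} × 0`. [folklore] -/
theorem pairEig_self (ε : ℤ) : pairEig W c M ε ε = (⊤ : AddSubgroup ↥(eigK W c M ε)).prod ⊥ := by
  rw [pairEig, if_pos rfl]

/-- `eig (−ε) = 0 × V^{−ε}` for a sign `ε`. [folklore] -/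
theorem pairEig_neg {ε : ℤ} (hε : ε = 1 ∨ ε = -1) :
    pairEig W c M ε (-ε) = (⊥ : AddSubgroup ↥(eigK W c M ε)).prod ⊤ := by
  rw [pairEig, if_neg (neg_ne_self_of_sign hε), if_pos rfl]

/-- The Selmer group of the pair: both components in `Sel_{2^M}(E/K)`. [cite: McCallumLMS1991, §4] -/
def pairSel (ε : ℤ) : AddSubgroup (PairV W c M ε) :=
  ((selmerGroup (W.baseChange K) ((2 ^ M : ℕ) : ℤ)).comap (eigK W c M ε).subtype).prod
    ((selmerGroup (W.baseChange K) ((2 ^ M : ℕ) : ℤ)).comap (eigK W c M (-ε)).subtype)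

/-- `Sel` is cut out by the local conditions `pairLoc`. [cite: McCallumLMS1991, §4] -/
theorem mem_pairSel_iff (ε : ℤ) (s : PairV W c M ε) :
    s ∈ pairSel W c M ε ↔ ∀ v, s ∈ pairLoc W c M ε v := by
  rw [pairSel, AddSubgroup.mem_prod, AddSubgroup.mem_comap, AddSubgroup.mem_comap, mem_selmerGroup_iff,
    mem_selmerGroup_iff, Sum.forall]
  constructor
  · rintro ⟨⟨h1f, h1i⟩, ⟨h2f, h2i⟩⟩
    exact ⟨fun v ↦ AddSubgroup.mem_prod.mpr ⟨h1f v, h2f v⟩,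
      fun w ↦ AddSubgroup.mem_prod.mpr ⟨h1i w, h2i w⟩⟩
  · rintro ⟨hf, hi⟩
    exact ⟨⟨fun v ↦ (AddSubgroup.mem_prod.mp (hf v)).1, fun w ↦ (AddSubgroup.mem_prod.mp (hi w)).1⟩,
      ⟨fun v ↦ (AddSubgroup.mem_prod.mp (hf v)).2, fun w ↦ (AddSubgroup.mem_prod.mp (hi w)).2⟩⟩

/-- Kolyvagin's class placed in the factor of its sign: `(c(n), 0)` for `r(n)` even, `(0, c(n))` for
`r(n)` odd, `0` off the square-free products of Kolyvagin primes. [cite: GrossLMS1991, Prop. 5.4 (2)]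
[cite: Kolyvagin1989Izv, §3] -/
def pairC (D : PointSystem N W K P 2 S M hdiv c) (n : ℕ) : PairV W c M D.ε :=
  if hn : KolSupp (fun ℓ ↦ IsKolyvaginPrime N W K 2 ℓ ∧ FrobEqFrobInfty W K (2 ^ M) ℓ ∧ S ℓ) n then
    if he : Even n.primeFactors.card then
      (⟨cK W c M hdiv D n, by
        have h := cK_mem_eigK W c M hdiv D hn
        rwa [he.neg_one_pow, mul_one] at h⟩, 0)
    else
      (0, ⟨cK W c M hdiv D n, by
        have h := cK_mem_eigK W c M hdiv D hn
        rwa [(Nat.not_even_iff_odd.mp he).neg_one_pow, mul_neg_one] at h⟩)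
  else 0

/-- `pairC` at an even-depth level. [folklore] -/
theorem pairC_of_even (D : PointSystem N W K P 2 S M hdiv c) {n : ℕ}
    (hn : KolSupp (fun ℓ ↦ IsKolyvaginPrime N W K 2 ℓ ∧ FrobEqFrobInfty W K (2 ^ M) ℓ ∧ S ℓ) n)
    (he : Even n.primeFactors.card) :
    (pairC W c M hdiv D n).1.1 = cK W c M hdiv D n ∧ (pairC W c M hdiv D n).2 = 0 := by
  unfold pairC
  rw [dif_pos hn, dif_pos he]
  exact ⟨rfl, rfl⟩

/-- `pairC` at an odd-depth level. [folklore] -/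
theorem pairC_of_odd (D : PointSystem N W K P 2 S M hdiv c) {n : ℕ}
    (hn : KolSupp (fun ℓ ↦ IsKolyvaginPrime N W K 2 ℓ ∧ FrobEqFrobInfty W K (2 ^ M) ℓ ∧ S ℓ) n)
    (he : ¬ Even n.primeFactors.card) :
    (pairC W c M hdiv D n).1 = 0 ∧ (pairC W c M hdiv D n).2.1 = cK W c M hdiv D n := by
  unfold pairC
  rw [dif_pos hn, dif_neg he]
  exact ⟨rfl, rfl⟩

/-- Gross Prop. 5.4 (2) in the pair: `c(n) ∈ eig (ε(−1)^{r(n)})`. [cite: GrossLMS1991, Prop. 5.4 (2)] -/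
theorem pairC_mem_pairEig (D : PointSystem N W K P 2 S M hdiv c) {n : ℕ}
    (hn : KolSupp (fun ℓ ↦ IsKolyvaginPrime N W K 2 ℓ ∧ FrobEqFrobInfty W K (2 ^ M) ℓ ∧ S ℓ) n) :
    pairC W c M hdiv D n ∈ pairEig W c M D.ε (D.ε * (-1) ^ n.primeFactors.card) := by
  by_cases he : Even n.primeFactors.card
  · rw [he.neg_one_pow, mul_one, pairEig_self, AddSubgroup.mem_prod]
    exact ⟨AddSubgroup.mem_top _, by rw [(pairC_of_even W c M hdiv D hn he).2]; exact zero_mem _⟩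
  · rw [(Nat.not_even_iff_odd.mp he).neg_one_pow, mul_neg_one, pairEig_neg W c M D.hε,
      AddSubgroup.mem_prod]
    exact ⟨by rw [(pairC_of_odd W c M hdiv D hn he).1]; exact zero_mem _, AddSubgroup.mem_top _⟩

/-- McCallum Lemma 4.3 / Gross Prop. 6.2 (1) in the pair: `c(n)` satisfies the Selmer condition at
every place not dividing `n` (nothing at the complex places of the imaginary quadratic `K`).
[cite: GrossLMS1991, Prop. 6.2 (1)] [cite: McCallumLMS1991, §4 Lemma 4.3] -/
theorem pairC_mem_pairLoc (hK : IsImaginaryQuadratic K) (D : PointSystem N W K P 2 S M hdiv c) {n : ℕ}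
    (hn : KolSupp (fun ℓ ↦ IsKolyvaginPrime N W K 2 ℓ ∧ FrobEqFrobInfty W K (2 ^ M) ℓ ∧ S ℓ) n)
    (v : Places K) (hv : ¬ Sum.elim (fun v : HeightOneSpectrum (𝓞 K) ↦ (n : 𝓞 K) ∈ v.asIdeal) (fun _ ↦ False) v) :
    pairC W c M hdiv D n ∈ pairLoc W c M D.ε v := by
  rcases v with v | w
  · have hsel := (D.rel n hn.1 hn.2).2.1 v hv
    change pairC W c M hdiv D n ∈ ((selmerLocalKer (W.baseChange K) (v.adicCompletion K) ((2 ^ M : ℕ) : ℤ)).comap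
        (eigK W c M D.ε).subtype).prod
      ((selmerLocalKer (W.baseChange K) (v.adicCompletion K) ((2 ^ M : ℕ) : ℤ)).comap
        (eigK W c M (-D.ε)).subtype)
    rw [AddSubgroup.mem_prod, AddSubgroup.mem_comap, AddSubgroup.mem_comap, AddSubgroup.coe_subtype,
      AddSubgroup.coe_subtype]
    by_cases he : Even n.primeFactors.card
    · obtain ⟨h1, h2⟩ := pairC_of_even W c M hdiv D hn he
      rw [h1, h2]
      exact ⟨hsel, by rw [ZeroMemClass.coe_zero]; exact zero_mem _⟩
    · obtain ⟨h1, h2⟩ := pairC_of_odd W c M hdiv D hn he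
      rw [h1, h2]
      exact ⟨by rw [ZeroMemClass.coe_zero]; exact zero_mem _, hsel⟩
  · change pairC W c M hdiv D n ∈ ((selmerLocalKer (W.baseChange K) w.Completion ((2 ^ M : ℕ) : ℤ)).comap
        (eigK W c M D.ε).subtype).prod
      ((selmerLocalKer (W.baseChange K) w.Completion ((2 ^ M : ℕ) : ℤ)).comap (eigK W c M (-D.ε)).subtype)
    rw [AddSubgroup.mem_prod, AddSubgroup.mem_comap, AddSubgroup.mem_comap]
    exact ⟨mem_selmerLocalKer_infinitePlace_of_isImaginaryQuadratic (W := W) hK _ w _,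
      mem_selmerLocalKer_infinitePlace_of_isImaginaryQuadratic (W := W) hK _ w _⟩

/-- For `ℓ m` square-free on the data's Kolyvagin primes with `ℓ` one of them: `m` is such a product,
`ℓ ∤ m`, and `r(ℓ m) = r(m) + 1`. [cite: GrossLMS1991, §3 (3.1)–(3.2)] -/
theorem kolSupp_of_mul {ℓ m : ℕ}
    (hℓ : IsKolyvaginPrime N W K 2 ℓ ∧ FrobEqFrobInfty W K (2 ^ M) ℓ ∧ S ℓ)
    (hℓm : KolSupp (fun ℓ ↦ IsKolyvaginPrime N W K 2 ℓ ∧ FrobEqFrobInfty W K (2 ^ M) ℓ ∧ S ℓ) (ℓ * m)) :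
    KolSupp (fun ℓ ↦ IsKolyvaginPrime N W K 2 ℓ ∧ FrobEqFrobInfty W K (2 ^ M) ℓ ∧ S ℓ) m ∧ ¬ ℓ ∣ m ∧
      (ℓ * m).primeFactors.card = m.primeFactors.card + 1 := by
  have hℓp : ℓ.Prime := hℓ.1.prime
  have hℓm0 : ℓ * m ≠ 0 := hℓm.1.ne_zero
  have hm0 : m ≠ 0 := fun h ↦ hℓm0 (by rw [h, mul_zero])
  have hm : KolSupp (fun ℓ ↦ IsKolyvaginPrime N W K 2 ℓ ∧ FrobEqFrobInfty W K (2 ^ M) ℓ ∧ S ℓ) m :=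
    ⟨hℓm.1.squarefree_of_dvd (dvd_mul_left m ℓ),
      fun q hq ↦ hℓm.2 q (Nat.primeFactors_mono (dvd_mul_left m ℓ) hℓm0 hq)⟩
  have hndvd : ¬ ℓ ∣ m := by
    intro hdvd
    have hsq : ℓ * ℓ ∣ ℓ * m := Nat.mul_dvd_mul_left ℓ hdvd
    exact hℓp.ne_one (Nat.isUnit_iff.mp (hℓm.1 ℓ hsq))
  exact ⟨hm, hndvd, SplitDataM.card_primeFactors_mul_of_not_dvd hℓp hm0 hndvd⟩

/-- McCallum Prop. 4.4 / Gross Prop. 6.2 (2) in the pair, ACROSS the factors: for a Kolyvagin prime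
`ℓ` and `ℓ m` square-free on the data's primes, `2^a c(ℓ m)` satisfies the Selmer condition at
`λ = (ℓ)` iff `2^a c(m)` vanishes at `λ`. [cite: McCallumLMS1991, §4 Prop. 4.4]
[cite: GrossLMS1991, Prop. 6.2 (2)] -/
theorem pairC_mem_pairLoc_iff (D : PointSystem N W K P 2 S M hdiv c) {ℓ m : ℕ}
    (hℓ : IsKolyvaginPrime N W K 2 ℓ ∧ FrobEqFrobInfty W K (2 ^ M) ℓ ∧ S ℓ)
    (hℓm : KolSupp (fun ℓ ↦ IsKolyvaginPrime N W K 2 ℓ ∧ FrobEqFrobInfty W K (2 ^ M) ℓ ∧ S ℓ) (ℓ * m))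
    (a : ℕ) :
    (((2 : ℕ) : ℤ) ^ a) • pairC W c M hdiv D (ℓ * m) ∈ pairLoc W c M D.ε (pairPl (N := N) W ℓ) ↔
      (((2 : ℕ) : ℤ) ^ a) • pairC W c M hdiv D m ∈ pairA (N := N) W c M D.ε ℓ := by
  have hℓp : ℓ.Prime := hℓ.1.prime
  obtain ⟨hm, -, hcard⟩ := kolSupp_of_mul W M hℓ hℓm
  -- Prop. 6.2 (2) for the class of `P_{ℓ m}` at `λ`
  have hrel := (D.rel (ℓ * m) hℓm.1 hℓm.2).2.2 ℓ hℓp (dvd_mul_right ℓ m) hℓ.1.place hℓ.1.mem_place a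
  rw [Nat.mul_div_cancel_left m hℓp.pos] at hrel
  change _ ↔ ((((2 : ℕ) : ℤ) ^ a) • kolyvaginClass (W.baseChange K) _ hdiv (D.hA m) (D.Pt m) (D.hPt m) ∈ _) at hrel
  rw [pairPl, dif_pos hℓ.1, pairA, dif_pos hℓ.1]
  change ((((2 : ℕ) : ℤ) ^ a) • pairC W c M hdiv D (ℓ * m) ∈
      ((selmerLocalKer (W.baseChange K) (hℓ.1.place.adicCompletion K) ((2 ^ M : ℕ) : ℤ)).comap
          (eigK W c M D.ε).subtype).prod
        ((selmerLocalKer (W.baseChange K) (hℓ.1.place.adicCompletion K) ((2 ^ M : ℕ) : ℤ)).comap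
          (eigK W c M (-D.ε)).subtype)) ↔ _
  rw [AddSubgroup.mem_prod, AddSubgroup.mem_comap, AddSubgroup.mem_comap, AddSubgroup.coe_subtype,
    AddSubgroup.coe_subtype, AddSubgroup.mem_prod, AddSubgroup.mem_comap, AddSubgroup.mem_comap,
    AddSubgroup.coe_subtype, AddSubgroup.coe_subtype]
  have e1 : ∀ (ε' : ℤ) (z : PairV W c M ε'), (((((2 : ℕ) : ℤ) ^ a) • z).1 : galH1Torsion (W.baseChange K)
      ((2 ^ M : ℕ) : ℤ)) = (((2 : ℕ) : ℤ) ^ a) • (z.1 : galH1Torsion (W.baseChange K) ((2 ^ M : ℕ) : ℤ)) :=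
    fun _ _ ↦ rfl
  have e2 : ∀ (ε' : ℤ) (z : PairV W c M ε'), (((((2 : ℕ) : ℤ) ^ a) • z).2 : galH1Torsion (W.baseChange K)
      ((2 ^ M : ℕ) : ℤ)) = (((2 : ℕ) : ℤ) ^ a) • (z.2 : galH1Torsion (W.baseChange K) ((2 ^ M : ℕ) : ℤ)) :=
    fun _ _ ↦ rfl
  rw [e1, e2, e1, e2]
  by_cases he : Even m.primeFactors.card
  · have hne : ¬ Even (m.primeFactors.card + 1) := Nat.not_even_iff_odd.mpr he.add_one
    obtain ⟨h1, h2⟩ := pairC_of_even W c M hdiv D hm he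
    obtain ⟨h3, h4⟩ := pairC_of_odd W c M hdiv D hℓm (by rwa [hcard])
    rw [h1, h2, h3, h4, ZeroMemClass.coe_zero, ZeroMemClass.coe_zero, zsmul_zero]
    exact ⟨fun h ↦ ⟨hrel.mp h.2, zero_mem _⟩, fun h ↦ ⟨zero_mem _, hrel.mpr h.1⟩⟩
  · have hoe : Even (m.primeFactors.card + 1) := (Nat.not_even_iff_odd.mp he).add_one
    obtain ⟨h1, h2⟩ := pairC_of_odd W c M hdiv D hm he
    obtain ⟨h3, h4⟩ := pairC_of_even W c M hdiv D hℓm (by rwa [hcard])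
    rw [h1, h2, h3, h4, ZeroMemClass.coe_zero, ZeroMemClass.coe_zero, zsmul_zero]
    exact ⟨fun h ↦ ⟨zero_mem _, hrel.mp h.1⟩, fun h ↦ ⟨hrel.mpr h.2, zero_mem _⟩⟩

/-- The Heegner class of the pair: `x = (δ x₀, 0)`. [cite: McCallumLMS1991, §5 Lemma 5.1] -/
def pairX {ε : ℤ} (x₀ : (W.baseChange K).toAffine.Point)
    (hxε : conjAct W c ((2 ^ M : ℕ) : ℤ) (kummerMapTorsion (W.baseChange K) _ hdiv x₀) =
      ε • kummerMapTorsion (W.baseChange K) _ hdiv x₀) : PairV W c M ε :=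
  (⟨kummerMapTorsion (W.baseChange K) _ hdiv x₀, hxε⟩, 0)

/-- Components of `2^j • x`. [folklore] -/
theorem pairX_zsmul {ε : ℤ} (x₀ : (W.baseChange K).toAffine.Point)
    (hxε : conjAct W c ((2 ^ M : ℕ) : ℤ) (kummerMapTorsion (W.baseChange K) _ hdiv x₀) =
      ε • kummerMapTorsion (W.baseChange K) _ hdiv x₀) (j : ℕ) :
    (((((2 : ℕ) : ℤ) ^ j) • pairX W c M hdiv x₀ hxε).1 : galH1Torsion (W.baseChange K) ((2 ^ M : ℕ) : ℤ)) =
        kummerMapTorsion (W.baseChange K) _ hdiv ((((2 : ℕ) : ℤ) ^ j) • x₀) ∧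
      ((((2 : ℕ) : ℤ) ^ j) • pairX W c M hdiv x₀ hxε).2 = 0 := by
  refine ⟨?_, ?_⟩
  · rw [map_zsmul]; rfl
  · change (((2 : ℕ) : ℤ) ^ j) • (0 : ↥(eigK W c M (-ε))) = 0
    exact zsmul_zero _

end Instance

end Summit.BirchSwinnertonDyer.BirchSwinnertonDyer.Theorems.KolyvaginPairDataTwo
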